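import Literature.Combinatorics.Optimization.PlanarConvexHullPolygon
import Literature.Combinatorics.Optimization.PentagonsPsdRankFour
import HarnessLib

/-!
# Nonnegative matrices of rank three have psd rank at most `4⌈min{p,q}/6⌉`
# (Gouveia–Robinson–Thomas, *Worst-case results for psd rank*, Theorem 3.7) — the typed fact
# `GouveiaRobinsonThomas2015_thm37` DISCHARGED

Source. J. Gouveia, R. Z. Robinson, R. R. Thomas, *Worst-case results for positive semidefinite
rank*, Math. Program. 153 (2015) 201–212 = arXiv:1305.4600 [GouveiaRobinsonThomas2015] (held text
`paper:arxiv-1305.4600`, p07), Theorem 3.7 (verbatim): "Let `M` be a nonnegative `p × q` matrix with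
`rank(M) = 3`. Then `rank_psd(M) ≤ 4⌈min{p,q}/6⌉`. In particular, the psd rank of a `v`-gon is at
most `4⌈v/6⌉`." Printed proof: "a `6 × q` nonnegative matrix of rank three is the generalized slack
matrix of a hexagon inside a `q`-gon and so has psd rank at most four" (Prop. 3.6, Thm. 3.4), then
concatenation of blocks of six rows (FGPRT Thm. 2.9 (iii)).

The fact was typed in `PentagonsPsdRankFour.lean` (`GouveiaRobinsonThomas2015_thm37`), where its
polygon clause is proved (`GouveiaRobinsonThomas2015_thm37_polygon`,
`IsConvexPolygon.hasPsdFactorization_four_mul_ceil_div_six`) together with Prop. 3.6 at the level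
of slack matrices (`IsConvexPolygon.hasPsdFactorization_of_valid`) and the `6 × q` sentence for row
points in convex position (`IsConvexPolygon.hasPsdFactorization_four_of_valid`); what was missing
for six — or `p` — ARBITRARY row points is the facial structure of their convex hull, now
`PlanarConvexHullPolygon.lean` (`exists_isConvexPolygon_of_finite`). This file assembles the proof:

* `hasPsdFactorization_two_of_line`: collinear row points cost `≤ 2` (a nonnegative factorization
  through the two extreme points, since affine functionals are affine in the line parameter);
* `hasPsdFactorization_of_valid_points` — **the geometric core of Thm. 3.7 for arbitrary point
  configurations**: for ANY finite family `x_i ∈ ℝ²` (`n` points, repetitions and collinearities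
  allowed) and affine functionals `L_s ≥ 0` at all `x_i`, the matrix `(L_s(x_i))` has a psd
  factorization of size `4⌈n/6⌉`: the extreme rows form a convex `v`-gon (`3 ≤ v ≤ n`) against
  which the `L_s` are valid (Prop. 3.6 ⇒ cost `≤ 4⌈v/6⌉`), and every other row is a convex
  combination of extreme rows (FGPRT Thm. 2.9 (iv) `HasPsdFactorization.mulLeft`, cost `0`) — so
  the printed blocks of six rows are taken among the hull VERTICES (inside
  `hasPsdFactorization_four_mul_ceil_div_six`), a recorded deviation that avoids classifying the
  hulls of six arbitrary points;
* `exists_cols_factorization_of_rank_eq_three`: a rank-three matrix factors through three of its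
  columns, `M = M[:,J]·C` — for a NONNEGATIVE `M` this makes row `i` the positive multiple `s_i` of a
  point `x_i` of the standard triangle (`s_i = M_{iJ₀}+M_{iJ₁}+M_{iJ₂}`; zero rows have `s_i = 0`) and
  column `j` an affine functional nonnegative at the `x_i` (the printed "generalized slack matrix of
  a polygon inside a polygon", with the inner polygon `conv{x_i}`);
* `hasPsdFactorization_of_rank_eq_three` (row form `4⌈p/6⌉`), the discharge
  **`GouveiaRobinsonThomas2015_thm37_holds`** (`min{p,q}` through `rank Mᵀ = rank M` and FGPRT
  Thm. 2.9 (i)), and `hasPsdFactorization_of_rank_le_three` (rank `≤ 3`, the smaller ranks by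
  Cohen–Rothblum `exists_nonnegFactorization_two_of_rank_le_two`).

* (appended) planar polytopes given by ARBITRARY finite generating sets `S` (through the hull
  polygon on `hullVertices S` in Graham order): `hasPsdLift_convexHull_finset` (psd lift of size
  `4⌈v/6⌉`, `v` = number of extreme points), `le_of_hasPsdLift_convexHull_finset` (no lift of size
  `≤ 2`, resp. `≤ 3` with `≥ 5` extreme points — GRT 2013 Thm. 4.7), and the facet description
  `exists_convexHull_finset_eq_halfplanes`.

NOT here: Theorem 2.1 (`GouveiaRobinsonThomas2015_thm21`, generic polytopes, still a typed fact);
§4 (quantifier elimination).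
-/

noncomputable section

open Matrix Finset

namespace Literature.Combinatorics.Optimization

/-! ### Valid affine functionals on an arbitrary finite planar point set -/

/-- Points on a line: the matrix `(L_s(p + t_i d))_{i,s}` of values of affine functionals
nonnegative at the points has a NONNEGATIVE factorization of size `2` through the two extreme
points (`L_s` is affine in `t`), hence a psd factorization of size `2`.
[cite: GouveiaRobinsonThomas2015, Thm. 3.7 proof (p07)] -/
theorem hasPsdFactorization_two_of_line {ι κ : Type*} [Fintype ι] (p d : Fin 2 → ℝ) (t : ι → ℝ)
    (g : κ → Fin 2 → ℝ) (c : κ → ℝ) (hL : ∀ s i, 0 ≤ g s ⬝ᵥ (p + t i • d) + c s) :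
    HasPsdFactorization (fun i s => g s ⬝ᵥ (p + t i • d) + c s) 2 := by
  classical
  rcases isEmpty_or_nonempty ι with hι | hι
  · exact ⟨fun i => isEmptyElim i, fun _ => 0, fun i => isEmptyElim i, fun _ => PosSemidef.zero,
      fun i => isEmptyElim i⟩
  have key : ∀ s (u : ℝ), g s ⬝ᵥ (p + u • d) + c s = (g s ⬝ᵥ p + c s) + u * (g s ⬝ᵥ d) := by
    intro s u
    rw [dotProduct_add, dotProduct_smul, smul_eq_mul]
    ring
  obtain ⟨i₀, -, h₀⟩ := exists_min_image univ t univ_nonempty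
  obtain ⟨i₁, -, h₁⟩ := exists_max_image univ t univ_nonempty
  by_cases heq : t i₀ = t i₁
  · -- a single point: rank one
    have ht : ∀ i, t i = t i₀ := fun i =>
      le_antisymm (heq ▸ h₁ i (mem_univ i)) (h₀ i (mem_univ i))
    refine (HasPsdFactorization.of_nonnegFactorization (k := 1) (fun _ _ => (1 : ℝ))
      (fun _ s => g s ⬝ᵥ (p + t i₀ • d) + c s) (fun _ _ => zero_le_one) (fun _ s => hL s i₀)
      (fun i s => ?_)).mono one_le_two
    simp [ht i]
  · have hΔ : 0 < t i₁ - t i₀ := sub_pos.mpr (lt_of_le_of_ne (h₀ i₁ (mem_univ _)) heq)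
    refine HasPsdFactorization.of_nonnegFactorization (k := 2)
      (fun i => ![(t i - t i₀) / (t i₁ - t i₀), (t i₁ - t i) / (t i₁ - t i₀)])
      (fun l s => ![g s ⬝ᵥ (p + t i₁ • d) + c s, g s ⬝ᵥ (p + t i₀ • d) + c s] l)
      (fun i l => ?_) (fun l s => ?_) (fun i s => ?_)
    · fin_cases l
      · exact div_nonneg (sub_nonneg.mpr (h₀ i (mem_univ i))) hΔ.le
      · exact div_nonneg (sub_nonneg.mpr (h₁ i (mem_univ i))) hΔ.le
    · fin_cases l
      · exact hL s i₁
      · exact hL s i₀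
    · simp only [Fin.sum_univ_two, Matrix.cons_val_zero, Matrix.cons_val_one]
      rw [key s (t i), key s (t i₁), key s (t i₀)]
      field_simp
      ring

/-- **GRT Theorem 3.7, geometric core for arbitrary point configurations**: for ANY finite family
of points `x_i ∈ ℝ²` (`n` of them, repetitions and collinearities allowed) and any family of
affine functionals `L_s(y) = g_s·y + c_s` nonnegative at all `x_i`, the matrix `(L_s(x_i))_{i,s}` has
a psd factorization of size `4⌈n/6⌉`. Proof: by `exists_isConvexPolygon_of_finite` either the
points are collinear (size `2`, `hasPsdFactorization_two_of_line`), or the extreme points of their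
hull form a convex `v`-gon, `3 ≤ v ≤ n`, against which the `L_s` are valid, so the extreme rows cost
`≤ rank_psd(v-gon) ≤ 4⌈v/6⌉` (Prop. 3.6 at matrix level `IsConvexPolygon.hasPsdFactorization_of_valid`
and the polygon clause `IsConvexPolygon.hasPsdFactorization_four_mul_ceil_div_six`), and every
other row is a convex combination of extreme rows (FGPRT Thm. 2.9 (iv), `HasPsdFactorization.mulLeft`).
[cite: GouveiaRobinsonThomas2015, Thm. 3.7 (p07)] -/
theorem hasPsdFactorization_of_valid_points {ι κ : Type*} [Fintype ι] (x : ι → (Fin 2 → ℝ))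
    (g : κ → Fin 2 → ℝ) (c : κ → ℝ) (hL : ∀ s i, 0 ≤ g s ⬝ᵥ x i + c s) :
    HasPsdFactorization (fun i s => g s ⬝ᵥ x i + c s) (4 * ((Fintype.card ι + 5) / 6)) := by
  classical
  rcases isEmpty_or_nonempty ι with hι | hι
  · exact ⟨fun i => isEmptyElim i, fun _ => 0, fun i => isEmptyElim i, fun _ => PosSemidef.zero,
      fun i => isEmptyElim i⟩
  have h4 : 4 ≤ 4 * ((Fintype.card ι + 5) / 6) := by
    have := Fintype.card_pos (α := ι)
    omega
  rcases exists_isConvexPolygon_of_finite x with ⟨p, d, t, hx⟩ | ⟨w, y, hy, hcard, hrange, hconv⟩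
  · have hfun : (fun i s => g s ⬝ᵥ x i + c s) = fun i s => g s ⬝ᵥ (p + t i • d) + c s := by
      funext i s; rw [hx i]
    rw [hfun]
    exact (hasPsdFactorization_two_of_line p d t g c (fun s i => by rw [← hx i]; exact hL s i)).mono
      (by omega)
  · have hval : ∀ s k, 0 ≤ g s ⬝ᵥ y k + c s := fun s k => by
      obtain ⟨i, hi⟩ := hrange ⟨k, rfl⟩
      rw [← hi]
      exact hL s i
    have hk := hy.hasPsdFactorization_of_valid (by omega)
      (hy.hasPsdFactorization_four_mul_ceil_div_six (by omega)) g c hval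
    choose W hW0 hW1 hWx using fun i => exists_weights_of_mem_convexHull_range y (hconv i)
    have hM : (fun i s => g s ⬝ᵥ x i + c s) = fun i s => ∑ k, W i k * (g s ⬝ᵥ y k + c s) := by
      funext i s
      rw [← hWx i, dotProduct_sum]
      simp only [dotProduct_smul, smul_eq_mul, mul_add, sum_add_distrib, ← sum_mul, hW1, one_mul]
    rw [hM]
    exact (hk.mulLeft (N := W) hW0).mono (by omega)

/-! ### Nonnegative matrices of rank three -/

/-- A real matrix of rank three factors through three of its columns: `M = M[:,J] · C`.
[cite: GouveiaRobinsonThomas2015, Thm. 3.7 proof (p07)] -/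
theorem exists_cols_factorization_of_rank_eq_three {p q : ℕ} (M : Matrix (Fin p) (Fin q) ℝ)
    (hM : M.rank = 3) :
    ∃ (J : Fin 3 → Fin q) (C : Fin q → Fin 3 → ℝ), ∀ i j, M i j = ∑ k, M i (J k) * C j k := by
  classical
  obtain ⟨t, ht_sub, ht_span, ht_li⟩ := exists_linearIndependent ℝ (Set.range M.col)
  have ht_fin : t.Finite := (Set.finite_range _).subset ht_sub
  letI : Fintype t := ht_fin.fintype
  have hcard : Fintype.card t = 3 := by
    rw [← Set.toFinset_card, ← finrank_span_set_eq_card ht_li, ht_span,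
      ← Matrix.rank_eq_finrank_span_cols, hM]
  let e : Fin 3 ≃ t := (Fintype.equivFinOfCardEq hcard).symm
  have hJ : ∀ k : Fin 3, ∃ j : Fin q, M.col j = (e k : Fin p → ℝ) := fun k => ht_sub (e k).2
  choose J hJ using hJ
  have hrange : Set.range (fun k : Fin 3 => (e k : Fin p → ℝ)) = t := by
    ext v
    constructor
    · rintro ⟨k, rfl⟩; exact (e k).2
    · intro hv; exact ⟨e.symm ⟨v, hv⟩, by simp⟩
  have hC : ∀ j : Fin q, ∃ cj : Fin 3 → ℝ, ∑ k, cj k • (e k : Fin p → ℝ) = M.col j := fun j => by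
    rw [← Submodule.mem_span_range_iff_exists_fun ℝ, hrange, ht_span]
    exact Submodule.subset_span ⟨j, rfl⟩
  choose C hC using hC
  refine ⟨J, C, fun i j => ?_⟩
  have h := congrFun (hC j) i
  simp only [Finset.sum_apply, Pi.smul_apply, smul_eq_mul] at h
  rw [show M i j = M.col j i from rfl, ← h]
  refine sum_congr rfl fun k _ => ?_
  rw [← hJ k, mul_comm]
  rfl

/-- **GRT Theorem 3.7, row form**: a nonnegative `p × q` matrix of rank three has a psd
factorization of size `4⌈p/6⌉`. The printed reduction made explicit: with three columns
`J` spanning the column space, row `i` is `s_i · (x_i, 1 − |x_i|)` for the point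
`x_i = (M_{iJ₀}, M_{iJ₁})/s_i` of the standard triangle, `s_i = M_{iJ₀} + M_{iJ₁} + M_{iJ₂}` (zero rows:
`s_i = 0`), and column `j` is the affine functional `L_j(y) = C_{j0}y₀ + C_{j1}y₁ + C_{j2}(1 − y₀ − y₁)`,
nonnegative at every `x_i`; so `M = diag(s) · (L_j(x_i))` and `hasPsdFactorization_of_valid_points`
applies (row scaling and zero rows are free, `HasPsdFactorization.mulLeft`).
[cite: GouveiaRobinsonThomas2015, Thm. 3.7 (p07)] -/
theorem hasPsdFactorization_of_rank_eq_three {p q : ℕ} (M : Matrix (Fin p) (Fin q) ℝ)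
    (hnn : ∀ i j, 0 ≤ M i j) (hM : M.rank = 3) : HasPsdFactorization M (4 * ((p + 5) / 6)) := by
  classical
  obtain ⟨J, C, hfac⟩ := exists_cols_factorization_of_rank_eq_three M hM
  let s : Fin p → ℝ := fun i => M i (J 0) + M i (J 1) + M i (J 2)
  have hs : ∀ i, 0 ≤ s i := fun i => add_nonneg (add_nonneg (hnn _ _) (hnn _ _)) (hnn _ _)
  have hzero : ∀ i, s i = 0 → ∀ j, M i j = 0 := by
    intro i hi j
    have h0 : M i (J 0) = 0 := by have := hnn i (J 0); have := hnn i (J 1); have := hnn i (J 2); simp only [s] at hi; linarith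
    have h1 : M i (J 1) = 0 := by have := hnn i (J 0); have := hnn i (J 1); have := hnn i (J 2); simp only [s] at hi; linarith
    have h2 : M i (J 2) = 0 := by have := hnn i (J 0); have := hnn i (J 1); have := hnn i (J 2); simp only [s] at hi; linarith
    rw [hfac, Fin.sum_univ_three, h0, h1, h2]
    ring
  -- the normalised points and the affine functionals
  let I := {i : Fin p // s i ≠ 0}
  let x : I → (Fin 2 → ℝ) := fun i => ![M i (J 0) / s i, M i (J 1) / s i]
  let g : Fin q → (Fin 2 → ℝ) := fun j => ![C j 0 - C j 2, C j 1 - C j 2]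
  let c : Fin q → ℝ := fun j => C j 2
  have hN : ∀ (i : I) j, g j ⬝ᵥ x i + c j = M i j / s i := by
    intro i j
    have hsi : s (i : Fin p) ≠ 0 := i.2
    rw [eq_div_iff hsi, hfac]
    simp only [x, g, c, dotProduct, Fin.sum_univ_two, Fin.sum_univ_three, Matrix.cons_val_zero,
      Matrix.cons_val_one]
    field_simp
    simp only [s]
    ring
  have hval : ∀ j (i : I), 0 ≤ g j ⬝ᵥ x i + c j := fun j i => by
    rw [hN]; exact div_nonneg (hnn _ _) (hs _)
  have hfacN := hasPsdFactorization_of_valid_points x g c hval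
  have hcardI : Fintype.card I ≤ p := (Fintype.card_subtype_le _).trans (by simp)
  let W : Fin p → I → ℝ := fun i i' => if (i' : Fin p) = i then s i else 0
  have hW : ∀ i i', 0 ≤ W i i' := fun i i' => by
    simp only [W]; split_ifs
    · exact hs i
    · exact le_rfl
  have hMW : M = fun i j => ∑ i' : I, W i i' * (g j ⬝ᵥ x i' + c j) := by
    funext i j
    by_cases hsi : s i = 0
    · rw [hzero i hsi j]
      symm
      refine sum_eq_zero fun i' _ => ?_
      have : (i' : Fin p) ≠ i := fun h => i'.2 (h ▸ hsi)
      simp [W, this]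
    · rw [Finset.sum_eq_single (⟨i, hsi⟩ : I) (fun i' _ hne => by
          have : (i' : Fin p) ≠ i := fun h => hne (Subtype.ext h)
          simp [W, this]) (by simp)]
      simp only [W, if_pos rfl]
      rw [hN]
      field_simp
  rw [hMW]
  exact (hfacN.mulLeft (N := W) hW).mono (Nat.mul_le_mul_left 4 (Nat.div_le_div_right (by omega)))

/-- **GRT Theorem 3.7 DISCHARGED** (p07, verbatim: "Let `M` be a nonnegative `p × q` matrix with
`rank(M) = 3`. Then `rank_psd(M) ≤ 4⌈min{p,q}/6⌉`."): the typed fact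
`GouveiaRobinsonThomas2015_thm37` holds — row form `hasPsdFactorization_of_rank_eq_three` applied to
`M` or to `Mᵀ` (`rank Mᵀ = rank M`, FGPRT Thm. 2.9 (i) `HasPsdFactorization.transpose`).
[cite: GouveiaRobinsonThomas2015, Thm. 3.7 (p07)] -/
theorem GouveiaRobinsonThomas2015_thm37_holds : GouveiaRobinsonThomas2015_thm37 := by
  intro p q M hnn hM
  rcases le_total p q with hpq | hqp
  · rw [min_eq_left hpq]
    exact hasPsdFactorization_of_rank_eq_three M hnn hM
  · rw [min_eq_right hqp]
    have hT := hasPsdFactorization_of_rank_eq_three Mᵀ (fun j i => hnn i j)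
      (by rw [Matrix.rank_transpose]; exact hM)
    exact hT.transpose


/-- **GRT Theorem 3.7 for rank at most three**: a nonnegative `p × q` matrix of rank `≤ 3` has a psd
factorization of size `4⌈min{p,q}/6⌉` (rank `3`: the theorem; rank `≤ 2`: Cohen–Rothblum gives a
nonnegative, hence psd, factorization of size `2 ≤ 4⌈min{p,q}/6⌉`, unless the matrix is empty).
[cite: GouveiaRobinsonThomas2015, Thm. 3.7 (p07)] -/
theorem hasPsdFactorization_of_rank_le_three {p q : ℕ} (M : Matrix (Fin p) (Fin q) ℝ)
    (hnn : ∀ i j, 0 ≤ M i j) (hM : M.rank ≤ 3) :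
    HasPsdFactorization M (4 * ((min p q + 5) / 6)) := by
  rcases Nat.lt_or_ge M.rank 3 with hlt | hge
  · obtain ⟨U, V, hU, hV, hMUV⟩ := exists_nonnegFactorization_two_of_rank_le_two hnn (by omega)
    have h2 := HasPsdFactorization.of_nonnegFactorization U V hU hV hMUV
    rcases Nat.eq_zero_or_pos (min p q) with h0 | hpos
    · rw [h0]
      refine hasPsdFactorization_zero_iff.mpr fun i j => ?_
      rcases Nat.eq_zero_or_pos p with hp | hp
      · subst hp; exact i.elim0
      · have hq : q = 0 := by omega
        subst hq; exact j.elim0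
    · exact h2.mono (by omega)
  · exact GouveiaRobinsonThomas2015_thm37_holds p q M hnn (le_antisymm hM hge)

/-! ### Planar polytopes given by arbitrary generators: psd lifts -/

/-- **Theorem 3.7 for polygons given by ARBITRARY generators, lift form**: the convex hull of a
finite planar point set with `v ≥ 3` extreme points (`v = #hullVertices`) is a linear image of an
affine slice of `S^{4⌈v/6⌉}_+` — the hull is the convex `v`-gon on its extreme points in Graham order
(`exists_isConvexPolygon_range_eq`), to which the polygon clause applies
(`GouveiaRobinsonThomas2015_thm37_polygon_lift`). [cite: GouveiaRobinsonThomas2015, Thm. 3.7 (p07)] -/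
theorem hasPsdLift_convexHull_finset (S : Finset (Fin 2 → ℝ)) (h3 : 3 ≤ (hullVertices S).card) :
    HasPsdLift (convexHull ℝ (↑S : Set (Fin 2 → ℝ))) (4 * (((hullVertices S).card + 5) / 6)) := by
  obtain ⟨w, hw⟩ : ∃ w, (hullVertices S).card = w + 1 := ⟨(hullVertices S).card - 1, by omega⟩
  obtain ⟨y, hy, hconv⟩ := exists_isConvexPolygon_range_eq _ (hullVertices_convexPosition S) hw
  rw [← convexHull_hullVertices, ← hy, hw]
  exact GouveiaRobinsonThomas2015_thm37_polygon_lift hconv (by omega)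

/-- **Lower bounds for planar polytopes given by arbitrary generators** (GRT 2013 Thm. 4.7 through the
hull polygon): a finite planar point set with at least `3` extreme points has no psd lift of size
`≤ 2`, and with at least `5` extreme points none of size `≤ 3`.
[cite: GouveiaRobinsonThomas2013, Thm. 4.7 (p11)] -/
theorem le_of_hasPsdLift_convexHull_finset (S : Finset (Fin 2 → ℝ)) {k : ℕ}
    (hk : HasPsdLift (convexHull ℝ (↑S : Set (Fin 2 → ℝ))) k) :
    (3 ≤ (hullVertices S).card → 3 ≤ k) ∧ (5 ≤ (hullVertices S).card → 4 ≤ k) := by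
  have key : ∀ {w : ℕ}, (hullVertices S).card = w + 1 →
      ∃ y : Fin (w + 1) → (Fin 2 → ℝ), IsConvexPolygon y ∧
        HasPsdLift (convexHull ℝ (Set.range y)) k := fun hw => by
    obtain ⟨y, hy, hconv⟩ := exists_isConvexPolygon_range_eq _ (hullVertices_convexPosition S) hw
    refine ⟨y, hconv, ?_⟩
    rwa [hy, convexHull_hullVertices]
  constructor
  · intro h3
    obtain ⟨y, hy, hlift⟩ := key (w := (hullVertices S).card - 1) (by omega)
    exact hy.three_le_of_hasPsdLift (by omega) hlift
  · intro h5
    obtain ⟨y, hy, hlift⟩ := key (w := (hullVertices S).card - 1) (by omega)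
    exact hy.four_le_of_hasPsdLift (by omega) hlift

/-- **Facet description of a planar polytope from arbitrary generators** (the hull polygon's edge
inequalities, `IsConvexPolygon.convexHull_eq`): for a finite planar point set with at least three
extreme points, `conv S` is the intersection of the `v` edge half-planes of the convex `v`-gon on its
extreme points in Graham order. [cite: CLRS2001, §33.3 Thm. 33.1 (pdf p0734)] -/
theorem exists_convexHull_finset_eq_halfplanes (S : Finset (Fin 2 → ℝ)) {w : ℕ}
    (hw : (hullVertices S).card = w + 3) :
    ∃ y : Fin (w + 3) → (Fin 2 → ℝ), IsConvexPolygon y ∧ Set.range y = ↑(hullVertices S) ∧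
      convexHull ℝ (↑S : Set (Fin 2 → ℝ)) = {z | ∀ j, polygonNormal y j ⬝ᵥ z ≤ polygonOffset y j} := by
  obtain ⟨y, hy, hconv⟩ := exists_isConvexPolygon_range_eq _ (hullVertices_convexPosition S)
    (w := w + 2) (by omega)
  refine ⟨y, hconv, hy, ?_⟩
  rw [← convexHull_hullVertices, ← hy]
  exact hconv.convexHull_eq (by omega)


end Literature.Combinatorics.Optimization
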